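import Summits.NavierStokesRegularity.NavierStokesRegularity.Theorems.TypeIliouvilleNoTypeII.Negative.NSIAncientCascadeGauges
import HarnessLib

/-!
# The ancient Euler-self-similar NSI cascade, III: classes and the weak gradient on `(-∞,0) × ℝ³`

Negative-lane support file for `stmt-NavierStokesRegularity-0056` (kill-kit, model class M2′),
bearing on the crux `PowerGaugeEulerLiouville` (item 19832) of the §B route `EulerZoomLiouville`.
For the ancient zoom-out `𝔘` of the super-similar NSI cascade on the Euler line
(`NSIAncientCascade`, characterised by its window property) this file verifies, on the ancient
slab `Q = (-∞,0) × ℝ³` of the crux, every CLASS hypothesis of `PowerGaugeEulerLiouville`: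
local integrability of `𝔘`, `|𝔘|²`, `p̃[𝔘]` (the first three conjuncts of
`IsDistributionalNSSolutionOn Q 0 0 𝔘 p̃[𝔘]`), the fields `energyClass` and `pressure` of
`IsSuitableWeakSolutionOn Q 0 0 𝔘 p̃[𝔘]`, the `L²_loc` bound of the slice derivative `D𝔘`, and
`HasWeakSpatialGradientOn Q 𝔘 D𝔘`. Mechanism: a compact `K ⊆ ℝ × ℝ³` has its times bounded
below, so it lies in ONE window `W_n = Φ_n⁻¹((0,∞) × ℝ³)` (`exists_window_of_isCompact`), on
which `𝔘`, `D𝔘`, `p̃[𝔘]` are the Euler rescalings of `𝔲`, `D𝔲`, `p̃[𝔲]`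
(`HasWeakSpatialGradientOn.stRescale`, `integrableOn_comp_stAffine_iff`); the quantitative bounds
are the ball bounds of part II. WHAT THIS IS NOT: nothing about NS/Euler solutions; the momentum
identity is not (and cannot be) verified.

References: Seregin, arXiv:2402.13229 (2024), (1.7); Ożański, arXiv:1709.00602 (2017), §2
[`Ozanski2017NSISingular`]; CKN 1982, §2.
-/

noncomputable section

open MeasureTheory Set Function Filter Topology Metric Module
open scoped ENNReal NNReal InnerProductSpace RealInnerProductSpace

set_option linter.dupNamespace false

namespace Summit.NavierStokesRegularity.NavierStokesRegularity.Theorems.TypeIliouvilleNoTypeIINegative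

open Literature.Analysis.FluidPDE Literature.Barriers.NavierStokesRegularity
open Literature.Barriers.NavierStokesRegularity.Scheffer TopologicalSpace

/-- Membership in the window `Φ⁻¹((0,∞) × ℝ³)`, `Φ(s,y) = (t₀ + βs, x₀ + γy)`. [folklore] -/
theorem mem_coe_stPreimage_positiveTimes_iff (β γ t₀ : ℝ) (x₀ : EuclideanSpace ℝ (Fin 3))
    (w : ℝ × EuclideanSpace ℝ (Fin 3)) :
    w ∈ ((stPreimage β γ t₀ x₀ positiveTimes : Opens (ℝ × EuclideanSpace ℝ (Fin 3))) :
      Set (ℝ × EuclideanSpace ℝ (Fin 3))) ↔ 0 < t₀ + β * w.1 := by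
  rw [coe_stPreimage, mem_preimage, coe_positiveTimes, mem_prod, stAffine_fst]
  simp only [mem_Ioi, mem_univ, and_true]

namespace IsSuperBlock

variable {T ν₀ τ σ a : ℝ} {z : EuclideanSpace ℝ (Fin 3)} {G : Set (EuclideanSpace ℝ (Fin 3))}
  {u : ℝ → EuclideanSpace ℝ (Fin 3) → EuclideanSpace ℝ (Fin 3)} {ρ : ℝ}
  {U : ℝ → EuclideanSpace ℝ (Fin 3) → EuclideanSpace ℝ (Fin 3)}

/-! ### One window for a compact set -/

/-- **A compact set of space–time lies in one window**: its times are bounded below.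
[folklore] -/
theorem exists_window_of_isCompact (h : IsSuperBlock T ν₀ τ σ a z G u)
    {K : Set (ℝ × EuclideanSpace ℝ (Fin 3))} (hK : IsCompact K) :
    ∃ n : ℕ, K ⊆ ((stPreimage (σ ^ (2 * n)) (τ ^ n) (blowupTime T σ) (blowupPoint τ z)
      positiveTimes : Opens (ℝ × EuclideanSpace ℝ (Fin 3))) : Set (ℝ × EuclideanSpace ℝ (Fin 3))) := by
  obtain ⟨S, hS⟩ := (hK.image continuous_fst).bddBelow
  obtain ⟨n, hn⟩ := h.exists_window_index S
  refine ⟨n, fun w hw => ?_⟩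
  have hSw : S ≤ w.1 := hS (mem_image_of_mem _ hw)
  rw [mem_coe_stPreimage_positiveTimes_iff]
  nlinarith [pow_pos h.σ_pos (2 * n)]

/-! ### `𝔘`, `D𝔘`, `p̃[𝔘]` on a window are the Euler rescalings of `𝔲`, `D𝔲`, `p̃[𝔲]` -/

/-- On the `n`-th window `𝔘 = a^{-n} 𝔲 ∘ Φ_n` pointwise. [folklore] -/
theorem ancient_apply_of_mem_window (h : IsSuperBlock T ν₀ τ σ a z G u)
    (hU : ∀ (n : ℕ) (s : ℝ), -blowupTime T σ ≤ σ ^ (2 * n) * s →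
      U s = ((a⁻¹) ^ n • stPull (σ ^ (2 * n)) (τ ^ n) (blowupTime T σ) (blowupPoint τ z)
        (glueG T σ τ a z u)) s)
    {n : ℕ} {s : ℝ} {y : EuclideanSpace ℝ (Fin 3)}
    (hw : (s, y) ∈ ((stPreimage (σ ^ (2 * n)) (τ ^ n) (blowupTime T σ) (blowupPoint τ z)
      positiveTimes : Opens (ℝ × EuclideanSpace ℝ (Fin 3))) : Set (ℝ × EuclideanSpace ℝ (Fin 3)))) :
    U s y = ((a⁻¹) ^ n • stPull (σ ^ (2 * n)) (τ ^ n) (blowupTime T σ) (blowupPoint τ z)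
        (glueG T σ τ a z u)) s y := by
  have _ := h.σ_pos
  rw [mem_coe_stPreimage_positiveTimes_iff] at hw
  dsimp only at hw
  rw [hU n s (by linarith)]

/-- On the `n`-th window `D𝔘 = a^{-n}τⁿ D𝔲 ∘ Φ_n` pointwise. [folklore] -/
theorem ancient_fderiv_of_mem_window (h : IsSuperBlock T ν₀ τ σ a z G u)
    (hU : ∀ (n : ℕ) (s : ℝ), -blowupTime T σ ≤ σ ^ (2 * n) * s →
      U s = ((a⁻¹) ^ n • stPull (σ ^ (2 * n)) (τ ^ n) (blowupTime T σ) (blowupPoint τ z)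
        (glueG T σ τ a z u)) s)
    {n : ℕ} {s : ℝ} {y : EuclideanSpace ℝ (Fin 3)}
    (hw : (s, y) ∈ ((stPreimage (σ ^ (2 * n)) (τ ^ n) (blowupTime T σ) (blowupPoint τ z)
      positiveTimes : Opens (ℝ × EuclideanSpace ℝ (Fin 3))) : Set (ℝ × EuclideanSpace ℝ (Fin 3)))) :
    fderiv ℝ (U s) y = (((a⁻¹) ^ n * τ ^ n) • stPull (σ ^ (2 * n)) (τ ^ n) (blowupTime T σ)
      (blowupPoint τ z) (fun s x => fderiv ℝ (glueG T σ τ a z u s) x)) s y := by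
  have _ := h.σ_pos
  rw [mem_coe_stPreimage_positiveTimes_iff] at hw
  dsimp only at hw
  rw [h.ancient_fderiv_slice hU (by linarith)]
  rfl

/-- On the `n`-th window `p̃[𝔘] = a^{-2n} p̃[𝔲] ∘ Φ_n` pointwise. [folklore] -/
theorem ancient_pressure_of_mem_window (h : IsSuperBlock T ν₀ τ σ a z G u)
    (hU : ∀ (n : ℕ) (s : ℝ), -blowupTime T σ ≤ σ ^ (2 * n) * s →
      U s = ((a⁻¹) ^ n • stPull (σ ^ (2 * n)) (τ ^ n) (blowupTime T σ) (blowupPoint τ z)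
        (glueG T σ τ a z u)) s)
    {n : ℕ} {s : ℝ} {y : EuclideanSpace ℝ (Fin 3)}
    (hw : (s, y) ∈ ((stPreimage (σ ^ (2 * n)) (τ ^ n) (blowupTime T σ) (blowupPoint τ z)
      positiveTimes : Opens (ℝ × EuclideanSpace ℝ (Fin 3))) : Set (ℝ × EuclideanSpace ℝ (Fin 3)))) :
    normalisedPressure (U s) y = ((((a⁻¹) ^ n) ^ 2) • stPull (σ ^ (2 * n)) (τ ^ n)
      (blowupTime T σ) (blowupPoint τ z) (fun s => normalisedPressure (glueG T σ τ a z u s))) s y := by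
  have _ := h.σ_pos
  rw [mem_coe_stPreimage_positiveTimes_iff] at hw
  dsimp only at hw
  rw [h.ancient_pressure_slice hU (by linarith)]
  rfl

/-! ### Integrability on windows and on compact sets -/

/-- **`𝔘 ∈ L¹(W_n)`** on every window (`𝔲 ∈ L¹((0,∞) × ℝ³)` and the change of variables).
[folklore] -/
theorem ancient_integrableOn_window (h : IsSuperBlock T ν₀ τ σ a z G u)
    (hU : ∀ (n : ℕ) (s : ℝ), -blowupTime T σ ≤ σ ^ (2 * n) * s →
      U s = ((a⁻¹) ^ n • stPull (σ ^ (2 * n)) (τ ^ n) (blowupTime T σ) (blowupPoint τ z)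
        (glueG T σ τ a z u)) s) (n : ℕ) :
    IntegrableOn (uncurry U) ((stPreimage (σ ^ (2 * n)) (τ ^ n) (blowupTime T σ) (blowupPoint τ z)
      positiveTimes : Opens (ℝ × EuclideanSpace ℝ (Fin 3))) : Set (ℝ × EuclideanSpace ℝ (Fin 3))) volume := by
  have hβn : 0 < σ ^ (2 * n) := pow_pos h.σ_pos _
  have hτn : 0 < τ ^ n := pow_pos h.τ_pos n
  have h1 := ((integrableOn_comp_stAffine_iff hβn hτn (blowupTime T σ) (blowupPoint τ z)
    (uncurry (glueG T σ τ a z u)) _).2 h.integrableOn_glueG).smul ((a⁻¹) ^ n)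
  rw [coe_stPreimage]
  refine IntegrableOn.congr_fun h1 ?_
    ((measurable_stAffine _ _ _ _) positiveTimes.isOpen.measurableSet)
  rintro ⟨s, y⟩ hw
  rw [← coe_stPreimage] at hw
  simp only [Pi.smul_apply, comp_apply, uncurry_apply_pair, stAffine_apply,
    h.ancient_apply_of_mem_window hU hw, smul_stPull_apply]

/-- **`|𝔘|² ∈ L¹(W_n)`** on every window. [folklore] -/
theorem ancient_integrableOn_sq_window (h : IsSuperBlock T ν₀ τ σ a z G u)
    (hU : ∀ (n : ℕ) (s : ℝ), -blowupTime T σ ≤ σ ^ (2 * n) * s →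
      U s = ((a⁻¹) ^ n • stPull (σ ^ (2 * n)) (τ ^ n) (blowupTime T σ) (blowupPoint τ z)
        (glueG T σ τ a z u)) s) (n : ℕ) :
    IntegrableOn (fun w : ℝ × EuclideanSpace ℝ (Fin 3) => ‖uncurry U w‖ ^ 2)
      ((stPreimage (σ ^ (2 * n)) (τ ^ n) (blowupTime T σ) (blowupPoint τ z)
        positiveTimes : Opens (ℝ × EuclideanSpace ℝ (Fin 3))) : Set (ℝ × EuclideanSpace ℝ (Fin 3))) volume := by
  have hβn : 0 < σ ^ (2 * n) := pow_pos h.σ_pos _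
  have hτn : 0 < τ ^ n := pow_pos h.τ_pos n
  have hαn : 0 ≤ (a⁻¹) ^ n := (pow_pos (inv_pos.2 h.gain_pos) n).le
  have h1 := (((integrableOn_comp_stAffine_iff hβn hτn (blowupTime T σ) (blowupPoint τ z)
    (fun q : ℝ × EuclideanSpace ℝ (Fin 3) => ‖glueG T σ τ a z u q.1 q.2‖ ^ 2) _).2
    h.integrable_norm_glueG_sq).const_mul (((a⁻¹) ^ n) ^ 2))
  rw [coe_stPreimage]
  refine IntegrableOn.congr_fun h1 ?_
    ((measurable_stAffine _ _ _ _) positiveTimes.isOpen.measurableSet)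
  rintro ⟨s, y⟩ hw
  rw [← coe_stPreimage] at hw
  simp only [comp_apply, uncurry_apply_pair, stAffine_apply, h.ancient_apply_of_mem_window hU hw,
    smul_stPull_apply, norm_smul, Real.norm_of_nonneg hαn, mul_pow]

/-- **`D𝔘 ∈ L¹(W_n)`** on every window. [folklore] -/
theorem ancient_integrableOn_fderiv_window (h : IsSuperBlock T ν₀ τ σ a z G u)
    (hU : ∀ (n : ℕ) (s : ℝ), -blowupTime T σ ≤ σ ^ (2 * n) * s →
      U s = ((a⁻¹) ^ n • stPull (σ ^ (2 * n)) (τ ^ n) (blowupTime T σ) (blowupPoint τ z)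
        (glueG T σ τ a z u)) s) (n : ℕ) :
    IntegrableOn (uncurry fun s y => fderiv ℝ (U s) y)
      ((stPreimage (σ ^ (2 * n)) (τ ^ n) (blowupTime T σ) (blowupPoint τ z)
        positiveTimes : Opens (ℝ × EuclideanSpace ℝ (Fin 3))) : Set (ℝ × EuclideanSpace ℝ (Fin 3))) volume := by
  have hβn : 0 < σ ^ (2 * n) := pow_pos h.σ_pos _
  have hτn : 0 < τ ^ n := pow_pos h.τ_pos n
  have h1 := ((integrableOn_comp_stAffine_iff hβn hτn (blowupTime T σ) (blowupPoint τ z)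
    (uncurry fun s x => fderiv ℝ (glueG T σ τ a z u s) x) _).2 h.integrableOn_fderiv_glueG).smul
    ((a⁻¹) ^ n * τ ^ n)
  rw [coe_stPreimage]
  refine IntegrableOn.congr_fun h1 ?_
    ((measurable_stAffine _ _ _ _) positiveTimes.isOpen.measurableSet)
  rintro ⟨s, y⟩ hw
  rw [← coe_stPreimage] at hw
  simp only [Pi.smul_apply, comp_apply, uncurry_apply_pair, stAffine_apply,
    h.ancient_fderiv_of_mem_window hU hw, stPull_apply]

/-- **`p̃[𝔘]` is a.e.-strongly measurable on every compact set** (it is `a^{-2n} p̃[𝔲] ∘ Φ_n` on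
a window containing it). [folklore] -/
theorem ancient_aestronglyMeasurable_pressure_of_isCompact (h : IsSuperBlock T ν₀ τ σ a z G u)
    (hU : ∀ (n : ℕ) (s : ℝ), -blowupTime T σ ≤ σ ^ (2 * n) * s →
      U s = ((a⁻¹) ^ n • stPull (σ ^ (2 * n)) (τ ^ n) (blowupTime T σ) (blowupPoint τ z)
        (glueG T σ τ a z u)) s)
    {K : Set (ℝ × EuclideanSpace ℝ (Fin 3))} (hK : IsCompact K) :
    AEStronglyMeasurable (uncurry fun s => normalisedPressure (U s)) (volume.restrict K) := by
  obtain ⟨n, hn⟩ := h.exists_window_of_isCompact hK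
  have hβn : 0 < σ ^ (2 * n) := pow_pos h.σ_pos _
  have hτn : 0 < τ ^ n := pow_pos h.τ_pos n
  have hg : AEStronglyMeasurable (fun w : ℝ × EuclideanSpace ℝ (Fin 3) => ((a⁻¹) ^ n) ^ 2 *
      (fun q : ℝ × EuclideanSpace ℝ (Fin 3) => normalisedPressure (glueG T σ τ a z u q.1) q.2)
        (stAffine (σ ^ (2 * n)) (τ ^ n) (blowupTime T σ) (blowupPoint τ z) w)) (volume.restrict K) :=
    ((h.aestronglyMeasurable_pressure_glueG.comp_quasiMeasurePreserving
      (quasiMeasurePreserving_stAffine hβn hτn _ _)).const_mul _).restrict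
  refine hg.congr ((ae_restrict_mem hK.measurableSet).mono ?_)
  rintro ⟨s, y⟩ hw
  simp only [uncurry_apply_pair, stAffine_apply, h.ancient_pressure_of_mem_window hU (hn hw),
    smul_stPull_apply, smul_eq_mul]

/-- A compact set of space–time lies in a cylinder `ℝ × B(0,R)`. [folklore] -/
theorem exists_subset_univ_prod_ball {K : Set (ℝ × EuclideanSpace ℝ (Fin 3))} (hK : IsCompact K) :
    ∃ R : ℝ, 0 < R ∧ K ⊆ (univ : Set ℝ) ×ˢ ball (0 : EuclideanSpace ℝ (Fin 3)) R := by
  obtain ⟨R, hR0, hR⟩ := (hK.image continuous_snd).isBounded.subset_ball_lt 0 0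
  exact ⟨R, hR0, fun w hw => ⟨mem_univ _, hR (mem_image_of_mem _ hw)⟩⟩

/-- **`p̃[𝔘] ∈ L¹(K)` for every compact `K`**: `L^{3/2}` on the cylinder `ℝ × B(0,R) ⊇ K`
(part II) and finiteness of the measure of `K`. [folklore] -/
theorem ancient_integrableOn_pressure_of_isCompact (h : IsSuperBlock T ν₀ τ σ a z G u)
    (hρ : a = τ ^ (-(1 + ρ)))
    (hU : ∀ (n : ℕ) (s : ℝ), -blowupTime T σ ≤ σ ^ (2 * n) * s →
      U s = ((a⁻¹) ^ n • stPull (σ ^ (2 * n)) (τ ^ n) (blowupTime T σ) (blowupPoint τ z)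
        (glueG T σ τ a z u)) s)
    {K : Set (ℝ × EuclideanSpace ℝ (Fin 3))} (hK : IsCompact K) :
    IntegrableOn (uncurry fun s => normalisedPressure (U s)) K volume := by
  obtain ⟨C, -, hC⟩ := h.ancient_lintegral_cylinder_pressure_le hρ hU
  obtain ⟨R, hR0, hKR⟩ := exists_subset_univ_prod_ball hK
  haveI : IsFiniteMeasure (volume.restrict K) := isFiniteMeasure_restrict.2 hK.measure_lt_top.ne
  have h32 : ∫⁻ w in K, ‖uncurry (fun s => normalisedPressure (U s)) w‖ₑ ^ (3 / 2 : ℝ) < ⊤ :=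
    ((lintegral_mono_set hKR).trans (hC 0 R hR0)).trans_lt ENNReal.ofReal_lt_top
  have h32c : (3 / 2 : ℝ≥0∞) = ((3 / 2 : NNReal) : ℝ≥0∞) := by
    rw [ENNReal.coe_div (by norm_num)]; norm_num
  have h1 : (1 : ℝ≥0∞) < 3 / 2 := by
    rw [h32c]; exact_mod_cast (by norm_num : (1 : NNReal) < 3 / 2)
  have htop : (3 / 2 : ℝ≥0∞) ≠ ⊤ := by rw [h32c]; exact ENNReal.coe_ne_top
  have hmem : MemLp (uncurry fun s => normalisedPressure (U s)) (3 / 2 : ℝ≥0∞) (volume.restrict K) := by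
    refine ⟨h.ancient_aestronglyMeasurable_pressure_of_isCompact hU hK, ?_⟩
    rw [eLpNorm_lt_top_iff_lintegral_rpow_enorm_lt_top (by norm_num) htop]
    have e : ((3 / 2 : ℝ≥0∞)).toReal = (3 / 2 : ℝ) := by
      rw [ENNReal.toReal_div]; norm_num
    rw [e]
    exact h32
  exact hmem.integrable h1.le

/-- **`𝔘`, `|𝔘|²`, `p̃[𝔘]`, `D𝔘` are locally integrable on the ancient slab** (indeed on all
of `ℝ × ℝ³`): the first three conjuncts of `IsDistributionalNSSolutionOn Q 0 0 𝔘 p̃[𝔘]` and the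
two integrability fields of `HasWeakSpatialGradientOn Q 𝔘 D𝔘`. [folklore] -/
theorem ancient_locallyIntegrableOn (h : IsSuperBlock T ν₀ τ σ a z G u) (hρ : a = τ ^ (-(1 + ρ)))
    (hU : ∀ (n : ℕ) (s : ℝ), -blowupTime T σ ≤ σ ^ (2 * n) * s →
      U s = ((a⁻¹) ^ n • stPull (σ ^ (2 * n)) (τ ^ n) (blowupTime T σ) (blowupPoint τ z)
        (glueG T σ τ a z u)) s) (Q : Opens (ℝ × EuclideanSpace ℝ (Fin 3))) :
    LocallyIntegrableOn (uncurry U) (Q : Set (ℝ × EuclideanSpace ℝ (Fin 3))) volume ∧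
    LocallyIntegrableOn (fun w => ‖uncurry U w‖ ^ 2) (Q : Set (ℝ × EuclideanSpace ℝ (Fin 3))) volume ∧
    LocallyIntegrableOn (uncurry fun s => normalisedPressure (U s))
      (Q : Set (ℝ × EuclideanSpace ℝ (Fin 3))) volume ∧
    LocallyIntegrableOn (uncurry fun s y => fderiv ℝ (U s) y)
      (Q : Set (ℝ × EuclideanSpace ℝ (Fin 3))) volume := by
  have hlc : IsLocallyClosed (Q : Set (ℝ × EuclideanSpace ℝ (Fin 3))) := Q.isOpen.isLocallyClosed
  refine ⟨(locallyIntegrableOn_iff hlc).2 fun K _ hK => ?_,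
    (locallyIntegrableOn_iff hlc).2 fun K _ hK => ?_,
    (locallyIntegrableOn_iff hlc).2 fun K _ hK => h.ancient_integrableOn_pressure_of_isCompact hρ hU hK,
    (locallyIntegrableOn_iff hlc).2 fun K _ hK => ?_⟩
  · obtain ⟨n, hn⟩ := h.exists_window_of_isCompact hK
    exact (h.ancient_integrableOn_window hU n).mono_set hn
  · obtain ⟨n, hn⟩ := h.exists_window_of_isCompact hK
    exact (h.ancient_integrableOn_sq_window hU n).mono_set hn
  · obtain ⟨n, hn⟩ := h.exists_window_of_isCompact hK
    exact (h.ancient_integrableOn_fderiv_window hU n).mono_set hn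

/-! ### The class fields of `IsSuitableWeakSolutionOn Q 0 0 𝔘 p̃[𝔘]` -/

/-- **`energyClass`**: on every compact `K` the spatial `L²` norms of `𝔘 1_K` are bounded for
EVERY time (by the slice bound `∫_{B(0,R)}|𝔘(s)|² ≤ C R^{1-2ρ}` of part II). [folklore] -/
theorem ancient_energyClass (h : IsSuperBlock T ν₀ τ σ a z G u) (hρ : a = τ ^ (-(1 + ρ)))
    (hU : ∀ (n : ℕ) (s : ℝ), -blowupTime T σ ≤ σ ^ (2 * n) * s →
      U s = ((a⁻¹) ^ n • stPull (σ ^ (2 * n)) (τ ^ n) (blowupTime T σ) (blowupPoint τ z)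
        (glueG T σ τ a z u)) s) (Q : Set (ℝ × EuclideanSpace ℝ (Fin 3))) :
    ∀ K ⊆ Q, IsCompact K → ∃ C : ℝ≥0, ∀ᵐ t : ℝ,
      ∫⁻ x, K.indicator (fun w : ℝ × EuclideanSpace ℝ (Fin 3) => ‖U w.1 w.2‖ₑ ^ 2) (t, x) ≤ C := by
  intro K _ hK
  obtain ⟨C, -, hC⟩ := h.ancient_lintegral_ball_norm_sq_le hρ hU
  obtain ⟨R, hR0, hKR⟩ := exists_subset_univ_prod_ball hK
  refine ⟨Real.toNNReal (C * R ^ (1 - 2 * ρ)), Eventually.of_forall fun t => ?_⟩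
  have hle : ∀ x, K.indicator (fun w : ℝ × EuclideanSpace ℝ (Fin 3) => ‖U w.1 w.2‖ₑ ^ 2) (t, x) ≤
      (ball (0 : EuclideanSpace ℝ (Fin 3)) R).indicator (fun x => ‖U t x‖ₑ ^ 2) x := by
    intro x
    by_cases hx : (t, x) ∈ K
    · rw [indicator_of_mem hx, indicator_of_mem (hKR hx).2]
    · rw [indicator_of_notMem hx]
      exact bot_le
  calc ∫⁻ x, K.indicator (fun w : ℝ × EuclideanSpace ℝ (Fin 3) => ‖U w.1 w.2‖ₑ ^ 2) (t, x)
      ≤ ∫⁻ x, (ball (0 : EuclideanSpace ℝ (Fin 3)) R).indicator (fun x => ‖U t x‖ₑ ^ 2) x :=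
        lintegral_mono hle
    _ = ∫⁻ x in ball (0 : EuclideanSpace ℝ (Fin 3)) R, ‖U t x‖ₑ ^ 2 :=
        lintegral_indicator measurableSet_ball _
    _ ≤ ENNReal.ofReal (C * R ^ (1 - 2 * ρ)) := hC t 0 R hR0

/-- **`pressure`**: `p̃[𝔘] ∈ L^{3/2}(K)` for every compact `K`. [folklore] -/
theorem ancient_pressureClass (h : IsSuperBlock T ν₀ τ σ a z G u) (hρ : a = τ ^ (-(1 + ρ)))
    (hU : ∀ (n : ℕ) (s : ℝ), -blowupTime T σ ≤ σ ^ (2 * n) * s →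
      U s = ((a⁻¹) ^ n • stPull (σ ^ (2 * n)) (τ ^ n) (blowupTime T σ) (blowupPoint τ z)
        (glueG T σ τ a z u)) s) (Q : Set (ℝ × EuclideanSpace ℝ (Fin 3))) :
    ∀ K ⊆ Q, IsCompact K →
      ∫⁻ w in K, ‖(fun s => normalisedPressure (U s)) w.1 w.2‖ₑ ^ (3 / 2 : ℝ) < ∞ := by
  intro K _ hK
  obtain ⟨C, -, hC⟩ := h.ancient_lintegral_cylinder_pressure_le hρ hU
  obtain ⟨R, hR0, hKR⟩ := exists_subset_univ_prod_ball hK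
  exact ((lintegral_mono_set hKR).trans (hC 0 R hR0)).trans_lt ENNReal.ofReal_lt_top

/-- **`∇𝔘 ∈ L²_loc`**: `∫_K |D𝔘|² < ∞` for every compact `K`. [folklore] -/
theorem ancient_gradientClass (h : IsSuperBlock T ν₀ τ σ a z G u) (hρ : a = τ ^ (-(1 + ρ)))
    (hU : ∀ (n : ℕ) (s : ℝ), -blowupTime T σ ≤ σ ^ (2 * n) * s →
      U s = ((a⁻¹) ^ n • stPull (σ ^ (2 * n)) (τ ^ n) (blowupTime T σ) (blowupPoint τ z)
        (glueG T σ τ a z u)) s) (Q : Set (ℝ × EuclideanSpace ℝ (Fin 3))) :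
    ∀ K ⊆ Q, IsCompact K →
      ∫⁻ w in K, ENNReal.ofReal (frobeniusNormSq ((fun s y => fderiv ℝ (U s) y) w.1 w.2)) < ∞ := by
  intro K _ hK
  obtain ⟨C, -, hC⟩ := h.ancient_lintegral_cylinder_frobeniusNormSq_le hρ hU
  obtain ⟨R, hR0, hKR⟩ := exists_subset_univ_prod_ball hK
  exact ((lintegral_mono_set hKR).trans (hC 0 R hR0)).trans_lt ENNReal.ofReal_lt_top

/-! ### The weak spatial gradient of `𝔘` on any open `Q` -/

/-- **`D𝔘` is a weak spatial gradient of `𝔘` on every open `Q ⊆ ℝ × ℝ³`** (in particular on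
the ancient slab): a test function has compact support, which lies in one window `W_n`; there the
identity is that of the Euler rescaling of `𝔲` (`HasWeakSpatialGradientOn.stRescale` of
`hasWeakSpatialGradientOn_glueG`), the integrands agreeing everywhere (both vanish off `W_n`).
[folklore] -/
theorem ancient_hasWeakSpatialGradientOn (h : IsSuperBlock T ν₀ τ σ a z G u)
    (hρ : a = τ ^ (-(1 + ρ)))
    (hU : ∀ (n : ℕ) (s : ℝ), -blowupTime T σ ≤ σ ^ (2 * n) * s →
      U s = ((a⁻¹) ^ n • stPull (σ ^ (2 * n)) (τ ^ n) (blowupTime T σ) (blowupPoint τ z)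
        (glueG T σ τ a z u)) s) (Q : Opens (ℝ × EuclideanSpace ℝ (Fin 3))) :
    HasWeakSpatialGradientOn Q U (fun s y => fderiv ℝ (U s) y) := by
  obtain ⟨hli, -, -, hlig⟩ := h.ancient_locallyIntegrableOn hρ hU Q
  refine ⟨hli, hlig, fun φ hφ v w => ?_⟩
  obtain ⟨n, hn⟩ := h.exists_window_of_isCompact hφ.hasCompactSupport.isCompact
  have hβn : 0 < σ ^ (2 * n) := pow_pos h.σ_pos _
  have hτn : 0 < τ ^ n := pow_pos h.τ_pos n
  set W : Opens (ℝ × EuclideanSpace ℝ (Fin 3)) := stPreimage (σ ^ (2 * n)) (τ ^ n) (blowupTime T σ)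
    (blowupPoint τ z) positiveTimes with hW
  have hφW : IsSpaceTimeTestOn W φ := ⟨hφ.contDiff, hφ.hasCompactSupport, hn⟩
  have hWG := h.hasWeakSpatialGradientOn_glueG.stRescale ((a⁻¹) ^ n) hβn hτn (blowupTime T σ)
    (blowupPoint τ z)
  have hid := hWG.integral_fderiv_mul_inner_eq φ hφW v w
  have e1 : (fun t => ∫ x, fderiv ℝ (φ t) x v * ⟪U t x, w⟫) = fun t => ∫ x, fderiv ℝ (φ t) x v *
      ⟪((a⁻¹) ^ n • stPull (σ ^ (2 * n)) (τ ^ n) (blowupTime T σ) (blowupPoint τ z)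
        (glueG T σ τ a z u)) t x, w⟫ := by
    funext t
    congr 1
    funext x
    by_cases hw : (t, x) ∈ (W : Set (ℝ × EuclideanSpace ℝ (Fin 3)))
    · rw [h.ancient_apply_of_mem_window hU hw]
    · rw [hφW.fderiv_slice_eq_zero hw]
      simp
  have e2 : (fun t => ∫ x, φ t x * ⟪(fun s y => fderiv ℝ (U s) y) t x v, w⟫) = fun t => ∫ x, φ t x *
      ⟪(((a⁻¹) ^ n * τ ^ n) • stPull (σ ^ (2 * n)) (τ ^ n) (blowupTime T σ) (blowupPoint τ z)
        (fun s y => fderiv ℝ (glueG T σ τ a z u s) y)) t x v, w⟫ := by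
    funext t
    congr 1
    funext x
    by_cases hw : (t, x) ∈ (W : Set (ℝ × EuclideanSpace ℝ (Fin 3)))
    · simp only [h.ancient_fderiv_of_mem_window hU hw]
    · rw [hφW.apply_eq_zero hw, zero_mul, zero_mul]
  rw [e1, e2]
  exact hid

end IsSuperBlock

end Summit.NavierStokesRegularity.NavierStokesRegularity.Theorems.TypeIliouvilleNoTypeIINegative

end
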